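import Mathlib
import Literature.Analysis.FluidPDE.LocalLerayRescaling
import Literature.Analysis.FluidPDE.KatoSymmetryCovariance
import Summits.NavierStokesRegularity.NavierStokesRegularity.Theorems.L3TimeExponentPincerGlobalNoSwirlLeray
import Summits.NavierStokesRegularity.NavierStokesRegularity.Theorems.L3TimeExponentPincerRescaledSymmetry
import Summits.NavierStokesRegularity.NavierStokesRegularity.Theorems.L3TimeExponentPincerConvergingAxes
import HarnessLib.Audit
import HarnessLib

/-!
# L3TimeExponentPincer — the normalised family of local Leray solutions (step 1 of the (J) reduction)

Support kernel for the crux `L3CascadeJaw` (item stmt-NavierStokesRegularity-19499) of route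
`L3TimeExponentPincer`; step 1 (parabolic normalisation) of the compactness reduction (J)
`CritSmoothingNoSwirlB ⇐ (SFL³)` of planner nsreg-p2's ROUND-12 §2b.  From a Tao-class
solution `(u, p)` (`ν = 1`) on `[0, T]` from an axisymmetric swirl-free datum `u₀`, a time
`t ∈ (0, T)` and a point `x`, the normalisation `y ↦ √t · W(t s, x + √t y)` of its global
classical extension `W` (`…GlobalNoSwirlLeray.exists_global_localLeray_of_noSwirl`) is, up to
modification at `s = 0`, a GLOBAL local Leray solution (covariance
`IsLocalLeraySolution.stRescale`) whose datum `y ↦ √t · u₀(x + √t y)` has the same `L³` norm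
as `u₀` (criticality of `L³`), is exactly axisymmetric and swirl-free about the vertical axis
through the horizontal point `b = -(√t)⁻¹ (x₀, x₁, 0)` (`…RescaledSymmetry`), as are all its
slices at positive times; it is jointly continuous on `{s > 0}`, and its value at `(1, 0)` is
`√t · u(t, x)`.

* `normalised_localLeray` — the single normalisation;
* `normalised_family` — applied to the blowing-up family of step 0
  (`…CritModulusNoSwirlSelection.exists_family_points_of_not_critSmoothingNoSwirlB`): local
  Leray solutions `v_k ∈ 𝒩(a_k)` with `‖a_k‖₃ ≤ A`, exact symmetry about vertical axes through
  horizontal points `b_k`, continuity on `{s > 0}` and `‖v_k(1, 0)‖ > k`.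

WHAT THIS IS NOT: not NS regularity or blow-up — bookkeeping (rescaling, symmetry, norms) over
proved tree theorems; the crux `L3CascadeJaw` is untouched; no crux claim.
-/

noncomputable section

open MeasureTheory Set Function Filter Topology TopologicalSpace Metric WithLp
open scoped ENNReal NNReal ContDiff RealInnerProductSpace

namespace Summit.NavierStokesRegularity.NavierStokesRegularity.Theorems.L3TimeExponentPincerNormalisedFamily

open Literature.Analysis.FluidPDE
open Summit.NavierStokesRegularity.NavierStokesRegularity.Theorems.L3TimeExponentPincerGlobalNoSwirlLeray
open Summit.NavierStokesRegularity.NavierStokesRegularity.Theorems.L3TimeExponentPincerRescaledSymmetry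
open Summit.NavierStokesRegularity.NavierStokesRegularity.Theorems.L3TimeExponentPincerConvergingAxes

/-! ### Small algebra -/

/-- `x + c • z = c • z - (-x)` (the translation convention of `IsLocalLeraySolution.stRescale`
versus that of `…RescaledSymmetry`). -/
theorem add_smul_eq_smul_sub_neg (x z : EuclideanSpace ℝ (Fin 3)) (c : ℝ) :
    x + c • z = c • z - -x := by
  rw [sub_neg_eq_add, add_comm]

/-- The horizontal projection `(a₀, a₁, 0)` of a point has the same horizontal components and
vanishing vertical component. -/
theorem horizontal_apply (a : EuclideanSpace ℝ (Fin 3)) :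
    (toLp 2 ![a 0, a 1, 0] : EuclideanSpace ℝ (Fin 3)) 0 = a 0 ∧
      (toLp 2 ![a 0, a 1, 0] : EuclideanSpace ℝ (Fin 3)) 1 = a 1 ∧
      (toLp 2 ![a 0, a 1, 0] : EuclideanSpace ℝ (Fin 3)) 2 = 0 := by
  simp

/-- The horizontal components of `y - (a₀, a₁, 0)` and `y - a` agree. -/
theorem sub_horizontal_apply (a y : EuclideanSpace ℝ (Fin 3)) :
    (y - toLp 2 ![a 0, a 1, 0]) 0 = (y - a) 0 ∧ (y - toLp 2 ![a 0, a 1, 0]) 1 = (y - a) 1 := by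
  simp

/-- The `L³` norm is invariant under translation of the argument. -/
theorem eLpNorm_comp_add_left (u₀ : EuclideanSpace ℝ (Fin 3) → EuclideanSpace ℝ (Fin 3))
    (hu : AEStronglyMeasurable u₀ volume) (x : EuclideanSpace ℝ (Fin 3)) (p : ℝ≥0∞) :
    eLpNorm (fun z => u₀ (x + z)) p volume = eLpNorm u₀ p volume :=
  eLpNorm_comp_measurePreserving hu (measurePreserving_add_left volume x)

/-! ### The single normalisation -/

/-- **Normalisation of a swirl-free Tao-class solution at `(t, x)`.**  Let `(u, p)` be a
Tao-class solution (`ν = 1`) on `[0, T]` from an axisymmetric swirl-free datum `u₀`, `t ∈ (0, T)`,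
`x ∈ ℝ³`, `c = √t`.  There are a datum `a` (namely `y ↦ c • u₀ (x + c • y)`), a GLOBAL local
Leray solution `(v, π) ∈ 𝒩(a)` and a horizontal point `b` (`b₂ = 0`) such that: `a ∈ L³` is
weakly divergence free with `‖a‖₃ = ‖u₀‖₃`; `a` and every slice `v s`, `s > 0`, are exactly
axisymmetric and swirl-free about the vertical axis through `b`; `v` is jointly continuous on
`{s > 0}`; and `v 1 0 = c • u t x`. -/
theorem normalised_localLeray {T : ℝ} (hT : 0 < T) {u₀ : EuclideanSpace ℝ (Fin 3) → EuclideanSpace ℝ (Fin 3)}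
    {u : ℝ → EuclideanSpace ℝ (Fin 3) → EuclideanSpace ℝ (Fin 3)} {p : ℝ → EuclideanSpace ℝ (Fin 3) → ℝ}
    (h : IsTaoSolutionOn T 1 u₀ u p) (hax : IsAxisymmetric u₀) (hns : HasNoSwirl u₀) {t : ℝ}
    (ht : t ∈ Ioo 0 T) (x : EuclideanSpace ℝ (Fin 3)) :
    ∃ (a : EuclideanSpace ℝ (Fin 3) → EuclideanSpace ℝ (Fin 3))
      (v : ℝ → EuclideanSpace ℝ (Fin 3) → EuclideanSpace ℝ (Fin 3))
      (π : ℝ → EuclideanSpace ℝ (Fin 3) → ℝ) (b : EuclideanSpace ℝ (Fin 3)),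
      MemLp a 3 volume ∧ IsWeaklyDivFree a ∧ eLpNorm a 3 volume = eLpNorm u₀ 3 volume ∧
      IsLocalLeraySolution 1 a v π ∧ b 2 = 0 ∧
      (∀ (θ : ℝ) y, a (b + rotZ θ (y - b)) = rotZ θ (a y)) ∧
      (∀ y, (y - b) 0 * a y 1 - (y - b) 1 * a y 0 = 0) ∧
      (∀ s, 0 < s → ∀ (θ : ℝ) y, v s (b + rotZ θ (y - b)) = rotZ θ (v s y)) ∧
      (∀ s, 0 < s → ∀ y, (y - b) 0 * v s y 1 - (y - b) 1 * v s y 0 = 0) ∧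
      ContinuousOn (uncurry v) {z : ℝ × EuclideanSpace ℝ (Fin 3) | 0 < z.1} ∧
      v 1 0 = Real.sqrt t • u t x := by
  obtain ⟨W, Q, V, Pv, hcl, hW0, hWu, hWsym, hV, hVW⟩ :=
    exists_global_localLeray_of_noSwirl hT h hax hns
  obtain ⟨-, hu3, hdiv⟩ := datum_memLp_isWeaklyDivFree hT h
  set c : ℝ := Real.sqrt t with hc_def
  have hc : 0 < c := Real.sqrt_pos.2 ht.1
  have hc0 : c ≠ 0 := hc.ne'
  have hc2 : c ^ 2 = t := Real.sq_sqrt ht.1.le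
  -- the rescaled local Leray solution
  have hresc := hV.stRescale hc hc (β := c ^ 2) (sq c) x
  have hν : c * 1 / c = 1 := by rw [mul_one, div_self hc0]
  rw [hν] at hresc
  -- the axis point and its horizontal projection
  set a₀ : EuclideanSpace ℝ (Fin 3) := c⁻¹ • (-x) with ha₀
  obtain ⟨hb0, hb1, hb2⟩ := horizontal_apply a₀
  refine ⟨fun y => c • u₀ (x + c • y), c • stPull (c ^ 2) c 0 x V, c ^ 2 • stPull (c ^ 2) c 0 x Pv,
    toLp 2 ![a₀ 0, a₀ 1, 0], ?_, ?_, ?_, hresc, hb2, ?_, ?_, ?_, ?_, ?_, ?_⟩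
  · -- `a ∈ L³`
    exact memLp_three_rescaleData (hu3.comp_measurePreserving (measurePreserving_add_left volume x)) hc
  · -- weakly divergence free
    have e : (fun z => u₀ (x + z)) = fun w => u₀ (w - -x) := by
      funext w; rw [sub_neg_eq_add, add_comm]
    have h1 : IsWeaklyDivFree fun z => u₀ (x + z) := by rw [e]; exact hdiv.comp_sub_right (-x)
    exact h1.nsRescaleData hc
  · -- `‖a‖₃ = ‖u₀‖₃`
    rw [show (fun y => c • u₀ (x + c • y)) = rescaleData c (fun z => u₀ (x + z)) from rfl,
      eLpNorm_three_rescaleData _ hc, eLpNorm_comp_add_left u₀ hu3.1 x]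
  · -- datum axisymmetric about the axis through `horizontal a₀`
    intro θ y
    rw [← rotZ_about_eq_of_horizontal_eq (a := a₀) hb0.symm hb1.symm θ y]
    show c • u₀ (x + c • (a₀ + rotZ θ (y - a₀))) = rotZ θ (c • u₀ (x + c • y))
    rw [add_smul_eq_smul_sub_neg, add_smul_eq_smul_sub_neg, ha₀]
    exact rescaled_axisymmetricAbout hax hc0 (-x) θ y
  · -- datum swirl-free about that axis
    intro y
    obtain ⟨e0, e1⟩ := sub_horizontal_apply a₀ y
    rw [e0, e1]
    show (y - a₀) 0 * (c • u₀ (x + c • y)) 1 - (y - a₀) 1 * (c • u₀ (x + c • y)) 0 = 0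
    rw [add_smul_eq_smul_sub_neg, ha₀]
    exact rescaled_swirlAbout_eq_zero hns hc0 (-x) y
  · -- slices axisymmetric at positive times
    intro s hs θ y
    have hs' : 0 < c ^ 2 * s := by positivity
    rw [← rotZ_about_eq_of_horizontal_eq (a := a₀) hb0.symm hb1.symm θ y]
    show c • V (0 + c ^ 2 * s) (x + c • (a₀ + rotZ θ (y - a₀))) =
      rotZ θ (c • V (0 + c ^ 2 * s) (x + c • y))
    rw [zero_add, hVW _ hs', add_smul_eq_smul_sub_neg, add_smul_eq_smul_sub_neg, ha₀]
    exact rescaled_slice_axisymmetricAbout hc0 (-x) (hWsym _ hs'.le).1 θ y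
  · -- slices swirl-free at positive times
    intro s hs y
    have hs' : 0 < c ^ 2 * s := by positivity
    obtain ⟨e0, e1⟩ := sub_horizontal_apply a₀ y
    rw [e0, e1]
    show (y - a₀) 0 * (c • V (0 + c ^ 2 * s) (x + c • y)) 1 -
        (y - a₀) 1 * (c • V (0 + c ^ 2 * s) (x + c • y)) 0 = 0
    rw [zero_add, hVW _ hs', add_smul_eq_smul_sub_neg, ha₀]
    exact rescaled_slice_swirlAbout_eq_zero hc0 (-x) (hWsym _ hs'.le).2 y
  · -- joint continuity on `{s > 0}`
    have hWc : ContinuousOn (uncurry W) (Ici (0 : ℝ) ×ˢ (univ : Set (EuclideanSpace ℝ (Fin 3)))) :=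
      hcl.smooth_velocity.continuousOn
    have hφ : Continuous fun z : ℝ × EuclideanSpace ℝ (Fin 3) => ((c ^ 2 * z.1 : ℝ), x + c • z.2) := by
      fun_prop
    have hmaps : MapsTo (fun z : ℝ × EuclideanSpace ℝ (Fin 3) => ((c ^ 2 * z.1 : ℝ), x + c • z.2))
        {z : ℝ × EuclideanSpace ℝ (Fin 3) | 0 < z.1} (Ici (0 : ℝ) ×ˢ univ) := fun z hz =>
      ⟨by have : (0 : ℝ) < z.1 := hz; show (0 : ℝ) ≤ c ^ 2 * z.1; positivity, mem_univ _⟩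
    have hg : ContinuousOn (fun z : ℝ × EuclideanSpace ℝ (Fin 3) => c • W (c ^ 2 * z.1) (x + c • z.2))
        {z : ℝ × EuclideanSpace ℝ (Fin 3) | 0 < z.1} :=
      ((hWc.comp hφ.continuousOn hmaps)).const_smul c
    refine hg.congr fun z hz => ?_
    have hz' : 0 < c ^ 2 * z.1 := by have : (0 : ℝ) < z.1 := hz; positivity
    show c • V (0 + c ^ 2 * z.1) (x + c • z.2) = c • W (c ^ 2 * z.1) (x + c • z.2)
    rw [zero_add, hVW _ hz']
  · -- the value at `(1, 0)`
    show c • V (0 + c ^ 2 * 1) (x + c • (0 : EuclideanSpace ℝ (Fin 3))) = c • u t x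
    rw [zero_add, mul_one, smul_zero, add_zero, hVW _ (by positivity), hc2, hWu t ⟨ht.1.le, ht.2⟩]

/-! ### The normalised blowing-up family -/

/-- **The normalised family.**  From the family of step 0 (for every `k` a Tao-class swirl-free
axisymmetric solution with `‖u₀‖₃ ≤ A`, a time `t ∈ (0, T)` and a point `x` with
`k t^{-1/2} < ‖u(t, x)‖`): for every `k` a GLOBAL local Leray solution `v_k ∈ 𝒩(a_k)` with
`a_k ∈ L³` weakly divergence free, `‖a_k‖₃ ≤ A`, `a_k` and all slices `v_k(s)`, `s > 0`, exactly
axisymmetric and swirl-free about the vertical axis through a horizontal point `b_k`, `v_k`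
jointly continuous on `{s > 0}`, and `‖v_k(1, 0)‖ > k`. -/
theorem normalised_family {A : ℝ}
    (hfam : ∀ k : ℕ, ∃ (T : ℝ) (u₀ : EuclideanSpace ℝ (Fin 3) → EuclideanSpace ℝ (Fin 3))
      (u : ℝ → EuclideanSpace ℝ (Fin 3) → EuclideanSpace ℝ (Fin 3)) (p : ℝ → EuclideanSpace ℝ (Fin 3) → ℝ)
      (t : ℝ) (x : EuclideanSpace ℝ (Fin 3)), 0 < T ∧ IsTaoSolutionOn T 1 u₀ u p ∧ IsAxisymmetric u₀ ∧
      HasNoSwirl u₀ ∧ eLpNorm u₀ 3 volume ≤ ENNReal.ofReal A ∧ t ∈ Ioo 0 T ∧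
      (k : ℝ) * t ^ (-(1 / 2 : ℝ)) < ‖u t x‖) :
    ∀ k : ℕ, ∃ (a : EuclideanSpace ℝ (Fin 3) → EuclideanSpace ℝ (Fin 3))
      (v : ℝ → EuclideanSpace ℝ (Fin 3) → EuclideanSpace ℝ (Fin 3))
      (π : ℝ → EuclideanSpace ℝ (Fin 3) → ℝ) (b : EuclideanSpace ℝ (Fin 3)),
      MemLp a 3 volume ∧ IsWeaklyDivFree a ∧ eLpNorm a 3 volume ≤ ENNReal.ofReal A ∧
      IsLocalLeraySolution 1 a v π ∧ b 2 = 0 ∧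
      (∀ (θ : ℝ) y, a (b + rotZ θ (y - b)) = rotZ θ (a y)) ∧
      (∀ y, (y - b) 0 * a y 1 - (y - b) 1 * a y 0 = 0) ∧
      (∀ s, 0 < s → ∀ (θ : ℝ) y, v s (b + rotZ θ (y - b)) = rotZ θ (v s y)) ∧
      (∀ s, 0 < s → ∀ y, (y - b) 0 * v s y 1 - (y - b) 1 * v s y 0 = 0) ∧
      ContinuousOn (uncurry v) {z : ℝ × EuclideanSpace ℝ (Fin 3) | 0 < z.1} ∧ (k : ℝ) < ‖v 1 0‖ := by
  intro k
  obtain ⟨T, u₀, u, p, t, x, hT, hsol, hax, hns, hA3, ht, hlt⟩ := hfam k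
  obtain ⟨a, v, π, b, ha3, hadiv, hnorm, hv, hb2, hax', hsw', hvax, hvsw, hcont, hv1⟩ :=
    normalised_localLeray hT hsol hax hns ht x
  refine ⟨a, v, π, b, ha3, hadiv, hnorm ▸ hA3, hv, hb2, hax', hsw', hvax, hvsw, hcont, ?_⟩
  rw [hv1]
  exact lt_norm_smul_of_lt ht.1 hlt

end Summit.NavierStokesRegularity.NavierStokesRegularity.Theorems.L3TimeExponentPincerNormalisedFamily

end
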